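import Summits.BirchSwinnertonDyer.BirchSwinnertonDyer.Theorems.EisensteinPrimesKummerTorsionH1
import Literature.NumberTheory.EllipticCurves.ZpCorankQuasiIso
import HarnessLib

/-!
# The kernel of `H¹(G, M₁) → H¹(G, M₂)` along a short exact sequence of discrete modules, COUNTED, and the
# local / global `H⁰` inputs of the V21 index road (cell `bsd-eis`, seat `bsd-line-x1-p1` LEAD g4; crux 2
# `GoodLatticeBDPValue` stmt-BirchSwinnertonDyer-19032, line `halves`, road steps (2) and (5))

HONEST FRAMING (cell `bsd-eis`, run/shared/lean/pub/bsd-eis/): Galois-cohomology bookkeeping for an arbitrary topological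
group `G` (no definition, no named fact, no `sorry`, no `Theses` import); nothing about any curve is asserted; BSD / IMC2 /
KY Thm. 1.4.1 are proved for NO curve. Helper `--supports stmt-BirchSwinnertonDyer-19032`; closes no registered stub.

## What

For a short exact sequence `0 → M₁ —j→ M₂ —q→ M₃ → 0` of discrete `G`-modules with continuous orbit maps, the cohomology
sequence gives `ker(j_* : H¹(G,M₁) → H¹(G,M₂)) = δ₀(M₃^G) ≅ M₃^G / q(M₂^G)`. §1 proves the COUNT
`#ker j_* · #q(M₂^G) = #M₃^G` (`natCard_ker_resH1Hom_mul_natCard_image_eq`, `M₃^G` finite; tree `IsSES.δ₀`,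
`δ₀_eq_zero_iff`, `map_one_δ₀`, `exists_δ₀_eq_of_map_one_eq_zero`), and `nsmul_discreteH1_eq_zero` (`H¹(G, N)` is `p`-torsion
when `N` is). §2 specialises to the inputs of `FiniteIndexCalculus.zpCorank_add_eq_of_index_inputs` (file
`…LambdaIdentityOfIndexInputs`): along the residual sequence `0 → N_ω → N_f → N_1 → 0` and the Kummer sequence
`0 → N_f —j→ B —p→ B → 0` (`j(N_f) = B[p]`, `B` `p`-divisible):
* `natCard_ker_resH1Hom_eq_of_noFixed` — if `N_f^G = 0` then `#ker(H¹(G,N_ω) → H¹(G,N_f)) = #N_1^G` (global step (5):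
  `= p^ε`, `ε = [𝟙̃ = 𝟙]`, since `E(K_∞)[p] = 0`);
* `natCard_ker_mul_natCard_ker_kummer_eq` — THE LOCAL CANCELLATION (road step (5), KY's Cases I–III): if `N_ω^G = 0`, `G`
  acts trivially on `N_1` and `B^G` is FINITE, then `#ker(H¹(G,N_ω) → H¹(G,N_f)) · #ker(H¹(G,N_f) → H¹(G,B)) = #N_1`
  (`= p` at each place `w ∣ v̄`: the first factor is `#N_1/#N_f^{G_w}`, the second `#(B^{G_w}/p) = #B^{G_w}[p] = #N_f^{G_w}`).

References: [SerreGaloisCohomology1997] I §2.2 (cohomology sequence); [MilneADT2006] I §2; [KellerYin2024] §1.3–1.4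
(arXiv:2402.12781v2: Prop. 1.3.2 (iii) `H⁰(K_w, M_f)` finite; Cases I–III of the proof of Thm. 1.4.1); the road memo
`Cruxes/GoodLatticeBDPValue/Lines/halves-imprimLambda-index-road.md` §2 (5).
-/

set_option autoImplicit false
set_option linter.dupNamespace false -- the summit namespace `…BirchSwinnertonDyer.BirchSwinnertonDyer.Theorems` (Sub = Summit, D-0017) trips it

noncomputable section

open scoped Classical AddSubgroup

universe u

namespace Summit.BirchSwinnertonDyer.BirchSwinnertonDyer.Theorems.ResidualIndexKummer

open CategoryTheory Function
open Literature.NumberTheory.EllipticCurves Literature.NumberTheory.GaloisRepresentations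

variable {G : Type u} [Group G] [TopologicalSpace G] [IsTopologicalGroup G]
variable {M₁ : Type u} [AddCommGroup M₁] [DistribMulAction G M₁] [TopologicalSpace M₁] [DiscreteTopology M₁]
variable {M₂ : Type u} [AddCommGroup M₂] [DistribMulAction G M₂] [TopologicalSpace M₂] [DiscreteTopology M₂]
variable {M₃ : Type u} [AddCommGroup M₃] [DistribMulAction G M₃] [TopologicalSpace M₃] [DiscreteTopology M₃]

/-! ## §1 The kernel of `j_*` along `0 → M₁ → M₂ → M₃ → 0`, counted -/

/-- **`H¹(G, N)` is `p`-torsion when `N` is.** [cite: SerreGaloisCohomology1997, I §2.2] -/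
theorem nsmul_discreteH1_eq_zero {p : ℕ} (hN : ∀ n : M₁, p • n = 0) (x : discreteH1 G M₁) : p • x = 0 := by
  obtain ⟨c, rfl⟩ := oneCocycleClass_surjective _ x
  have hc : (p : ℤ) • c = 0 := Subtype.ext (ContinuousMap.ext fun σ ↦ by
    change (p : ℤ) • c.1 σ = 0
    rw [natCast_zsmul, hN])
  rw [← Nat.cast_smul_eq_nsmul ℤ, ← oneCocycleClass_smul, hc, oneCocycleClass_zero]

/-- **`#ker(j_* : H¹(G,M₁) → H¹(G,M₂)) · #q(M₂^G) = #M₃^G`** for a short exact sequence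
`0 → M₁ —j→ M₂ —q→ M₃ → 0` of discrete `G`-modules with continuous orbit maps and `M₃^G` finite: the cohomology
sequence `M₂^G → M₃^G —δ₀→ H¹(G, M₁) —j_*→ H¹(G, M₂)` is exact, so `ker j_* = im δ₀ ≅ M₃^G / q(M₂^G)`.
[cite: SerreGaloisCohomology1997, I §2.2 (Prop. 2)] [cite: MilneADT2006, I §2] -/
theorem natCard_ker_resH1Hom_mul_natCard_image_eq (j : M₁ →+ M₂) (q : M₂ →+ M₃)
    (hj : ∀ (g : G) (a : M₁), j (ContinuousMonoidHom.id G g • a) = g • j a)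
    (hq : ∀ (g : G) (b : M₂), q (g • b) = g • q b) (hinj : Injective j)
    (hex : ∀ b : M₂, q b = 0 ↔ b ∈ j.range) (hsurj : Surjective q)
    (hcont₁ : ∀ a : M₁, Continuous fun g : G ↦ g • a) (hcont₂ : ∀ b : M₂, Continuous fun g : G ↦ g • b)
    (hcont₃ : ∀ c : M₃, Continuous fun g : G ↦ g • c) [Finite {c : M₃ // ∀ g : G, g • c = c}] :
    Nat.card (resH1Hom (ContinuousMonoidHom.id G) j hj).ker *
        Nat.card {c : M₃ // (∀ g : G, g • c = c) ∧ ∃ b : M₂, (∀ g : G, g • b = b) ∧ q b = c} =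
      Nat.card {c : M₃ // ∀ g : G, g • c = c} := by
  have hj' : ∀ (g : G) (a : M₁), j (g • a) = g • j a := hj
  -- the continuous representations (definitionally `discreteTopRep`)
  let ρ₁ : ContinuousRep G ℤ M₁ :=
    { toRepresentation := (discreteContRep G M₁).toRepresentation
      continuous_smul := continuous_prod_of_discrete_right.mpr hcont₁ }
  let ρ₂ : ContinuousRep G ℤ M₂ :=
    { toRepresentation := (discreteContRep G M₂).toRepresentation
      continuous_smul := continuous_prod_of_discrete_right.mpr hcont₂ }
  let ρ₃ : ContinuousRep G ℤ M₃ :=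
    { toRepresentation := (discreteContRep G M₃).toRepresentation
      continuous_smul := continuous_prod_of_discrete_right.mpr hcont₃ }
  let f : ρ₁.toTopRep ⟶ ρ₂.toTopRep :=
    TopRep.ofHom ⟨⟨j.toIntLinearMap, continuous_of_discreteTopology⟩, fun σ ↦ by
      ext a; exact hj' σ a⟩
  let g : ρ₂.toTopRep ⟶ ρ₃.toTopRep :=
    TopRep.ofHom ⟨⟨q.toIntLinearMap, continuous_of_discreteTopology⟩, fun σ ↦ by
      ext b; exact hq σ b⟩
  have hf : ∀ a : M₁, f.hom a = j a := fun _ ↦ rfl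
  have hg : ∀ b : M₂, g.hom b = q b := fun _ ↦ rfl
  have hSES : IsSES f g :=
    { comp_eq_zero := by
        ext a
        change q (j a) = 0
        exact (hex (j a)).mpr ⟨a, rfl⟩
      injective := hinj
      exact_mid := fun y hy ↦ by
        obtain ⟨a, ha⟩ := (hex y).mp hy
        exact ⟨a, ha⟩
      surjective := fun c ↦ hsurj c }
  -- `j_* = H¹(f)`
  have hjfφ : ∀ φ : contOneCocycles ρ₁.toTopRep,
      resH1Hom (ContinuousMonoidHom.id G) j hj (oneCocycleClass (discreteTopRep G M₁) φ) =
        cohomologyMap f 1 (oneCocycleClass ρ₁.toTopRep φ) := by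
    intro φ
    rw [resH1Hom_id_oneCocycleClass, cohomologyMap_oneCocycleClass]
    exact congrArg (oneCocycleClass (discreteTopRep G M₂)) (Subtype.ext (ContinuousMap.ext fun _ ↦ rfl))
  have hjf : ∀ x : continuousCohomology 1 ρ₁.toTopRep,
      (resH1Hom (ContinuousMonoidHom.id G) j hj : discreteH1 G M₁ → discreteH1 G M₂) x = cohomologyMap f 1 x := by
    intro x
    obtain ⟨φ, rfl⟩ := oneCocycleClass_surjective ρ₁.toTopRep x
    exact hjfφ φ
  -- `ker j_* = im δ₀`, `ker δ₀ = q(M₂^G)`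
  let δ := hSES.δ₀.toAddMonoidHom
  have hrange : δ.range = (resH1Hom (ContinuousMonoidHom.id G) j hj).ker := by
    ext x
    constructor
    · rintro ⟨v, rfl⟩
      refine (AddMonoidHom.mem_ker).2 ?_
      refine (hjf (hSES.δ₀ v)).trans ?_
      exact hSES.map_one_δ₀ v
    · intro hx
      have hx' : cohomologyMap f 1 x = 0 := (hjf x).symm.trans ((AddMonoidHom.mem_ker).1 hx)
      obtain ⟨v, hv⟩ := hSES.exists_δ₀_eq_of_map_one_eq_zero x hx'
      exact ⟨v, hv⟩
  have hcount := natCard_eq_card_ker_mul_card_range δ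
  -- identify the three cardinals
  have e₁ : Nat.card ρ₃.toTopRep.ρ.invariants = Nat.card {c : M₃ // ∀ g : G, g • c = c} :=
    Nat.card_congr (Equiv.subtypeEquivRight fun c ↦ Iff.rfl)
  have e₂ : Nat.card δ.ker =
      Nat.card {c : M₃ // (∀ g : G, g • c = c) ∧ ∃ b : M₂, (∀ g : G, g • b = b) ∧ q b = c} := by
    refine Nat.card_congr ⟨fun v ↦ ⟨(v.1 : M₃), fun σ ↦ v.1.2 σ, ?_⟩,
      fun c ↦ ⟨⟨(c : M₃), fun σ ↦ c.2.1 σ⟩, ?_⟩, fun _ ↦ rfl, fun _ ↦ rfl⟩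
    · obtain ⟨w, hw, hwv⟩ := (hSES.δ₀_eq_zero_iff v.1).1 v.2
      exact ⟨w, fun σ ↦ hw σ, hwv⟩
    · obtain ⟨b, hb, hbc⟩ := c.2.2
      exact (hSES.δ₀_eq_zero_iff _).2 ⟨b, fun σ ↦ hb σ, hbc⟩
  rw [e₁, e₂, hrange, mul_comm] at hcount
  exact hcount.symm

/-! ## §2 The `H⁰` inputs of the index road -/

/-- **Global step (5): `#ker(H¹(G,N_ω) → H¹(G,N_f)) = #N_1^G` when `N_f^G = 0`** (then `q(N_f^G) = 0`): e.g. over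
`G = Gal(K̄/K_∞)` with `E(K_∞)[p] = 0`, the kernel of `H¹(K_∞, 𝔽(ω̃)) → H¹(K_∞, E[p])` has order `#𝔽(𝟙̃)^{G_{K_∞}} = p^ε`.
[cite: KellerYin2024, §1.4 proof of Lemma `SelfSelomega` (arXiv:2402.12781v2 TeX L1191–1200)] -/
theorem natCard_ker_resH1Hom_eq_of_noFixed (j : M₁ →+ M₂) (q : M₂ →+ M₃)
    (hj : ∀ (g : G) (a : M₁), j (ContinuousMonoidHom.id G g • a) = g • j a)
    (hq : ∀ (g : G) (b : M₂), q (g • b) = g • q b) (hinj : Injective j)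
    (hex : ∀ b : M₂, q b = 0 ↔ b ∈ j.range) (hsurj : Surjective q)
    (hcont₁ : ∀ a : M₁, Continuous fun g : G ↦ g • a) (hcont₂ : ∀ b : M₂, Continuous fun g : G ↦ g • b)
    (hcont₃ : ∀ c : M₃, Continuous fun g : G ↦ g • c) [Finite {c : M₃ // ∀ g : G, g • c = c}]
    (hno : ∀ b : M₂, (∀ g : G, g • b = b) → b = 0) :
    Nat.card (resH1Hom (ContinuousMonoidHom.id G) j hj).ker = Nat.card {c : M₃ // ∀ g : G, g • c = c} := by
  have h := natCard_ker_resH1Hom_mul_natCard_image_eq j q hj hq hinj hex hsurj hcont₁ hcont₂ hcont₃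
  have hone : Nat.card {c : M₃ // (∀ g : G, g • c = c) ∧ ∃ b : M₂, (∀ g : G, g • b = b) ∧ q b = c} = 1 := by
    rw [Nat.card_eq_one_iff_unique]
    refine ⟨⟨fun a b ↦ Subtype.ext ?_⟩, ⟨⟨0, fun g ↦ smul_zero g, 0, fun g ↦ smul_zero g, map_zero q⟩⟩⟩
    obtain ⟨b₁, hb₁, h₁⟩ := a.2.2
    obtain ⟨b₂, hb₂, h₂⟩ := b.2.2
    rw [← h₁, ← h₂, hno b₁ hb₁, hno b₂ hb₂]
  rw [hone, mul_one] at h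
  exact h

/-- **THE LOCAL CANCELLATION (road step (5); Keller–Yin's Cases I–III).** Along `0 → N_ω —i→ N_f —π→ N_1 → 0` and the
Kummer sequence `0 → N_f —j→ B —p→ B → 0` (`j(N_f) = B[p]`, `B` `p`-divisible) of discrete `G`-modules with continuous orbits:
if `N_ω^G = 0`, `G` acts trivially on the finite `N_1`, and `B^G` is FINITE, then
`#ker(i_* : H¹(G,N_ω) → H¹(G,N_f)) · #ker(j_* : H¹(G,N_f) → H¹(G,B)) = #N_1`.
(First factor `= #N_1 / #N_f^G` since `π` embeds `N_f^G` in `N_1`; second `= #(B^G/pB^G) = #B^G[p] = #j(N_f^G)`.) At a place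
`w ∣ v̄` of `K_∞` with `N_f = E[p]`, `B = E[p^∞]`: `#𝔽(ω)^{G_w} = 1`, `𝟙̃|_{G_w} = 1`, `E(K_{∞,w})[p^∞]` finite, so the product is
`p` WHATEVER `δ_w = dim E(K_{∞,w})[p]` is. [cite: KellerYin2024, §1.3 Prop. 1.3.2 (iii) and §1.4 Cases I–III (arXiv:2402.12781v2 TeX L919–953, L1142–1331)] -/
theorem natCard_ker_mul_natCard_ker_kummer_eq {B : Type u} [AddCommGroup B] [DistribMulAction G B]
    [TopologicalSpace B] [DiscreteTopology B] {p : ℕ} [Fact p.Prime]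
    (i : M₁ →+ M₂) (π : M₂ →+ M₃) (j : M₂ →+ B)
    (hi : ∀ (g : G) (a : M₁), i (ContinuousMonoidHom.id G g • a) = g • i a)
    (hπ : ∀ (g : G) (b : M₂), π (g • b) = g • π b) (hiinj : Injective i)
    (hexπ : ∀ b : M₂, π b = 0 ↔ b ∈ i.range) (hπsurj : Surjective π)
    (hj : ∀ (g : G) (b : M₂), j (ContinuousMonoidHom.id G g • b) = g • j b) (hjinj : Injective j)
    (hrange : ∀ x : B, x ∈ j.range ↔ p • x = 0) (hdiv : ∀ x : B, ∃ x' : B, p • x' = x)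
    (hcont₁ : ∀ a : M₁, Continuous fun g : G ↦ g • a) (hcont₂ : ∀ b : M₂, Continuous fun g : G ↦ g • b)
    (hcont₃ : ∀ c : M₃, Continuous fun g : G ↦ g • c) (hcontB : ∀ x : B, Continuous fun g : G ↦ g • x)
    (hω : ∀ a : M₁, (∀ g : G, g • a = a) → a = 0) (htriv : ∀ (g : G) (c : M₃), g • c = c) [Finite M₃]
    [Finite {x : B // ∀ g : G, g • x = x}] :
    Nat.card (resH1Hom (ContinuousMonoidHom.id G) i hi).ker * Nat.card (resH1Hom (ContinuousMonoidHom.id G) j hj).ker =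
      Nat.card M₃ := by
  have hj' : ∀ (g : G) (b : M₂), j (g • b) = g • j b := hj
  have hi' : ∀ (g : G) (a : M₁), i (g • a) = g • i a := hi
  -- the invariants of `M₂` form a finite group (they embed in `B^G` by `j`)
  haveI : Finite {b : M₂ // ∀ g : G, g • b = b} :=
    Finite.of_injective (fun b : {b : M₂ // ∀ g : G, g • b = b} ↦
      (⟨j (b : M₂), fun g ↦ by rw [← hj', b.2 g]⟩ : {x : B // ∀ g : G, g • x = x}))
      fun a b h ↦ Subtype.ext (hjinj (congrArg Subtype.val h))
  haveI : Finite {c : M₃ // ∀ g : G, g • c = c} := inferInstance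
  -- (a) `#ker i_* · #π(N_f^G) = #N_1^G = #N_1`
  have hA := natCard_ker_resH1Hom_mul_natCard_image_eq i π hi hπ hiinj hexπ hπsurj hcont₁ hcont₂ hcont₃
  have eN1 : Nat.card {c : M₃ // ∀ g : G, g • c = c} = Nat.card M₃ :=
    Nat.card_congr (Equiv.subtypeUnivEquiv fun c g ↦ htriv g c)
  -- `π` is injective on `N_f^G` (its kernel `i(N_ω)` meets `N_f^G` in `i(N_ω^G) = 0`)
  have eimπ : Nat.card {c : M₃ // (∀ g : G, g • c = c) ∧ ∃ b : M₂, (∀ g : G, g • b = b) ∧ π b = c} =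
      Nat.card {b : M₂ // ∀ g : G, g • b = b} := by
    symm
    refine Nat.card_congr (Equiv.ofBijective
      (fun b ↦ ⟨π (b : M₂), fun g ↦ by rw [← hπ, b.2 g], (b : M₂), b.2, rfl⟩) ⟨?_, ?_⟩)
    · intro a b hab
      have h0 : π ((a : M₂) - (b : M₂)) = 0 := by
        rw [map_sub, sub_eq_zero]; exact Subtype.ext_iff.mp hab
      obtain ⟨n, hn⟩ := (hexπ _).1 h0
      have hninv : ∀ g : G, g • n = n := fun g ↦ hiinj (by
        rw [hi', hn, smul_sub, a.2 g, b.2 g])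
      have hn0 : n = 0 := hω n hninv
      rw [hn0, map_zero] at hn
      exact Subtype.ext (sub_eq_zero.1 hn.symm)
    · rintro ⟨c, hc, b, hb, hbc⟩
      exact ⟨⟨b, hb⟩, Subtype.ext hbc⟩
  rw [eimπ, eN1] at hA
  -- (b) `#ker j_* · #(p B^G) = #B^G` and `#B^G = #B^G[p] · #(p B^G)`, `B^G[p] ≅ N_f^G`
  let mulp : B →+ B := p • AddMonoidHom.id B
  have hmulp : ∀ x : B, mulp x = p • x := fun _ ↦ rfl
  have hB := natCard_ker_resH1Hom_mul_natCard_image_eq (M₃ := B) j mulp hj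
    (fun g x ↦ by rw [hmulp, hmulp, smul_comm]) hjinj
    (fun x ↦ by rw [hmulp]; exact (hrange x).symm) (fun x ↦ by obtain ⟨x', hx'⟩ := hdiv x; exact ⟨x', hx'⟩)
    hcont₂ hcontB hcontB
  -- `B^G` as a group and multiplication by `p` on it
  let BG : AddSubgroup B :=
    { carrier := {x | ∀ g : G, g • x = x}
      add_mem' := fun {a b} ha hb g ↦ by rw [smul_add, ha g, hb g]
      zero_mem' := fun g ↦ smul_zero g
      neg_mem' := fun {a} ha g ↦ by rw [smul_neg, ha g] }
  let mp : BG →+ BG := p • AddMonoidHom.id BG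
  have hmp : ∀ x : BG, ((mp x : BG) : B) = p • (x : B) := fun _ ↦ rfl
  have hBG := natCard_eq_card_ker_mul_card_range mp
  have eBG : Nat.card BG = Nat.card {x : B // ∀ g : G, g • x = x} := Nat.card_congr (Equiv.refl _)
  have eker : Nat.card mp.ker = Nat.card {b : M₂ // ∀ g : G, g • b = b} := by
    symm
    refine Nat.card_congr (Equiv.ofBijective
      (fun b ↦ ⟨⟨j (b : M₂), fun g ↦ by rw [← hj', b.2 g]⟩, by
        rw [AddMonoidHom.mem_ker]
        exact Subtype.ext (by rw [hmp]; exact (hrange _).1 ⟨(b : M₂), rfl⟩)⟩) ⟨?_, ?_⟩)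
    · intro a b hab
      exact Subtype.ext (hjinj (congrArg (fun z : mp.ker ↦ ((z : BG) : B)) hab))
    · rintro ⟨⟨x, hx⟩, hxk⟩
      have hpx : p • x = 0 := by
        have := congrArg (fun z : BG ↦ (z : B)) ((AddMonoidHom.mem_ker).1 hxk)
        rwa [hmp] at this
      obtain ⟨b, rfl⟩ := (hrange x).2 hpx
      exact ⟨⟨b, fun g ↦ hjinj (by rw [hj', hx g])⟩, rfl⟩
  have erange : Nat.card mp.range =
      Nat.card {c : B // (∀ g : G, g • c = c) ∧ ∃ b : B, (∀ g : G, g • b = b) ∧ mulp b = c} := by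
    refine Nat.card_congr (Equiv.ofBijective
      (fun y ↦ ⟨((y : BG) : B), (y : BG).2, by
        obtain ⟨x, hx⟩ := y.2
        exact ⟨(x : B), x.2, by rw [hmulp, ← hmp, hx]⟩⟩) ⟨?_, ?_⟩)
    · intro a b hab
      simp only [Subtype.mk.injEq] at hab
      exact Subtype.ext (Subtype.ext hab)
    · rintro ⟨c, hc, b, hb, hbc⟩
      refine ⟨⟨⟨c, hc⟩, ⟨b, hb⟩, Subtype.ext ?_⟩, rfl⟩
      rw [hmp]; exact hbc
  rw [eBG, eker, erange] at hBG
  -- combine: `#ker i_* · #N_f^G = #N_1`, `#ker j_* · #im = #B^G = #N_f^G · #im`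
  rw [hBG] at hB
  haveI : Finite {c : B // (∀ g : G, g • c = c) ∧ ∃ b : B, (∀ g : G, g • b = b) ∧ mulp b = c} :=
    Finite.of_injective (fun c ↦ (⟨(c : B), c.2.1⟩ : {x : B // ∀ g : G, g • x = x}))
      fun a b h ↦ by
        simp only [Subtype.mk.injEq] at h
        exact Subtype.ext h
  haveI : Nonempty {c : B // (∀ g : G, g • c = c) ∧ ∃ b : B, (∀ g : G, g • b = b) ∧ mulp b = c} :=
    ⟨⟨0, fun g ↦ smul_zero g, 0, fun g ↦ smul_zero g, map_zero mulp⟩⟩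
  have hpos : 0 < Nat.card {c : B // (∀ g : G, g • c = c) ∧ ∃ b : B, (∀ g : G, g • b = b) ∧ mulp b = c} :=
    Nat.card_pos
  have hkerj : Nat.card (resH1Hom (ContinuousMonoidHom.id G) j hj).ker = Nat.card {b : M₂ // ∀ g : G, g • b = b} :=
    Nat.eq_of_mul_eq_mul_right hpos hB
  rw [hkerj]
  exact hA

end Summit.BirchSwinnertonDyer.BirchSwinnertonDyer.Theorems.ResidualIndexKummer

end
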